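import Mathlib
import HarnessLib
import Summits.ABC.ABC.Theses.NegOmegaAtlas
import Literature.NumberTheory.DiophantineGeometry.AbcWave0QualityFormProofs

/-!
# Line `birth` — BC3 skeleton for the crux `NegThesis` (stmt-ABC-1224)

Route `NegOmegaAtlas` (route-ABC-NegOmegaAtlas, negative side, `closes : NegThesis → … → ¬ABC`), crux
`NegThesis := ∃ k, ∃ δ > 0, {abc triples (a,b,c) with ω(abc) ≤ k and quality > 1 + δ}.Infinite`
(the route's thesis X; auto-crux since 2026-08-16: a hypothesis of `closes` nothing in the route derives).

THE LINE = SUPPLY ∧ UPGRADE, CUT ALONG THE ATLAS ("bounded-ω abc-hits first").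
`NegThesis` is EXISTENTIAL (an infinite family exists), so it has no conjunctive regime split (regimes split an
existential into a disjunction — that is the route's own `AtlasDichotomy : NegThesis ↔ UnbalancedFamily ∨
BalancedFamily`). The only exact conjunctive shape is the bridge `T ∧ (T → X)` of BC2(c), and the natural `T` is the
δ = 0 shadow of X: **bounded-ω abc-HITS** (abc triples with `ω(abc) ≤ k` and `rad(abc) < c`, the tree's hit notion of
`Literature.NumberTheory.DiophantineGeometry.abcHitCount`) are infinite for some `k`. The upgrade `T → X` is then cut
by the atlas cells AT HIT LEVEL, so that the seam is a real proof (the hit-level atlas dichotomy) and each arrow is a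
separate Diophantine problem:

* `stub_boundedOmegaHits` — SUPPLY: `∃ k, {hits with ω(abc) ≤ k}.Infinite`. Strictly weaker than the crux (δ = 0
  instead of δ > 0; `hits_of_negThesis` below), NOT decided by ABC (Baker's ω-refinement `c < 6/5·N(log N)^ω/ω!`
  allows `c > N` at every ω), and OPEN: every known infinite family of hits — `1 + (9ⁿ−1) = 9ⁿ`, the Pell hits
  `1 + 8y² = x²`, `p² ∣ 2^{p(p−1)} − 1` — has UNBOUNDED ω(abc) (primitive prime divisors), no infinite subfamily
  of bounded ω is known (an almost-prime problem for exponential / Lucas sequences at prime index), and the negation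
  "for each k only finitely many hits with ω(abc) ≤ k" is known only for k ≤ 2 (the route's `TwoSlotCell`).
* `stub_unbalancedHitsUpgrade` — UPGRADE IN CELL (II-U): if for some `k, η > 0` infinitely many ω ≤ k hits are
  η-unbalanced (`min(a,b) ≤ c^(1−η)`, the route's `UnbalancedFamily` coordinate: "√-scale Pillai" near-coincidences
  `b ≈ c` of bounded-ω power-rich numbers), then some bounded-ω family has quality bounded away from 1.
* `stub_balancedHitsUpgrade` — UPGRADE IN CELL (II-B): if for some `k` and EVERY `η > 0` infinitely many ω ≤ k hits
  are η-balanced (`c^(1−η) < min(a,b)`, the `BalancedFamily` coordinate: "prime Beal with mixed exponents"), then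
  some bounded-ω family has quality bounded away from 1.
* `NegThesis_of : stub₁-sig → stub₂-sig → stub₃-sig → NegThesis` — REAL proof (no sorry): fix the level `k` of the
  infinite hit family; either some `η > 0` leaves infinitely many η-unbalanced hits (apply stub 2), or for every
  `η > 0` the η-unbalanced hits are finite and their complement inside the infinite hit family — the η-balanced
  hits — is infinite (apply stub 3). This is `AtlasDichotomy` one level down (hits instead of violators).
* `hits_of_negThesis`, `crux_iff_stubs` — sorry-free: a violator is a hit (`quality > 1 + δ ⇒ rad(abc)^(1+δ) < c ⇒
  rad(abc) < c`, via `IsABCTriple.one_add_lt_quality_iff`), and both arrows conclude the crux, so the split is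
  EXACT: `NegThesis ↔ stub₁-sig ∧ stub₂-sig ∧ stub₃-sig`. No stub is refutable short of `¬NegThesis`; refuting
  stub 1 ("bounded-ω hits are finite at every level") refutes the crux and closes the route (kill criterion (a)).

Why `rad(abc) < c` is kept in the cell hypotheses: without it "infinitely many η-unbalanced bounded-ω abc triples"
is KNOWN (a = 1, b = p, c = p + 1 = 2·P₂, Chen) and the unbalanced arrow would be the crux in costume.
Honest status: under the standard heuristics stub 1 is true for large k and both arrows are false (ABC); the
anti-abc content of the crux sits in the arrows, where any disproof of abc at bounded ω must do its work — the cut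
isolates the ABC-consistent, independently attackable existential content (stub 1) from it, and adds no strength.

`sorry` occurs ONLY in the three `stub_*` theorems.
-/

-- `Summit.<Summit>.<Problem>`: for the single-conjunct summit `ABC` the duplicate `ABC.ABC` is mandated.
set_option linter.dupNamespace false

namespace Summit.ABC.ABC.Cruxes.NegThesis.Birth

open Literature.NumberTheory.DiophantineGeometry
open Summit.ABC.ABC.Theses.NegOmegaAtlas

/-! ## The three registered OPEN stubs -/

/-- **Stub 1 (SUPPLY — bounded-ω abc-hits are infinite).** For some `k` there are infinitely many abc triples
`(a,b,c)` with `ω(abc) ≤ k` and `rad(abc) < c` (abc *hits*, the notion counted by `abcHitCount`). The δ = 0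
shadow of the crux: implied by it (`hits_of_negThesis`), strictly weaker in appearance (a hit family may have
quality → 1, as Baker's ω-refinement `c < 6/5·N(log N)^ω/ω!` predicts and permits), not decided by ABC.
OPEN: every known infinite hit family (`1 + (9ⁿ−1) = 9ⁿ`; Pell `1 + 8y² = x²`; Wieferich-type `p² ∣ 2^{p(p−1)}−1`)
has unbounded ω(abc) (primitive prime divisors) and no infinite subfamily of bounded ω is known — that is an
almost-prime problem for exponential / Lucas sequences at prime index, out of reach of sieves; the negation "finitely
many hits at each level k" is the ε-free, constant-1 bounded-ω abc theorem known only at k ≤ 2 (`TwoSlotCell`). Why it might fail: structured families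
`(1, q^{2p} − 1, q^{2p})` carry two independent primitive parts `Φ_p(q), Φ_{2p}(q)`, so even heuristically each
contributes finitely many bounded-ω members (Σ 1/p² < ∞); the ω(abc) ≤ 3 hit census (19 hits with c ≤ 10⁹, none
above 2¹⁷, evidence on stmt-ABC-1227) shows no tail at k = 3.
Sources: BakerWustholz2007 §3.7 p.52; EvertseGyory2015 §4.6; Dahmen2008 (hit counts, ω free);
deWeger2026 = arXiv:2602.08051 §5; route items TwoSlotCell (stmt-ABC-1231), ThreeSlotFamily census (stmt-ABC-1227). -/
theorem stub_boundedOmegaHits :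
    ∃ k : ℕ, {t : ℕ × ℕ × ℕ | IsABCTriple t.1 t.2.1 t.2.2 ∧
      (t.1 * t.2.1 * t.2.2).primeFactors.card ≤ k ∧ rad t.1 t.2.1 t.2.2 < t.2.2}.Infinite := by
  sorry

/-- **Stub 2 (UPGRADE in cell (II-U) — unbalanced bounded-ω hits upgrade to a δ-family).** If for some `k` and
`η > 0` there are infinitely many abc hits with `ω(abc) ≤ k` and `min(a,b) ≤ c^(1−η)` (the route's
`UnbalancedFamily` coordinate: a term of size ≤ c^(1−η) against two bounded-ω power-rich numbers `b ≈ c` with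
`rad(abc) < c` — a "√-scale Pillai" near-coincidence family), then for some `k', δ > 0` there are infinitely many
abc triples with `ω(abc) ≤ k'` and quality `> 1 + δ`. Implied by the crux (it concludes it). The natural proof
shape stays in the cell (conclude `UnbalancedFamily`): along such a family the certified wall
`UnbalancedQuasiPolynomial` gives `log c ≪_k (log rad)^k · log log c`, so the primes grow like
`exp((log c)^{1/k − o(1)})` and the saving `log c − log rad(abc) > 0` of a hit must be shown to reach `δ' · log c`
infinitely often — a power saving in a Pillai-type coincidence with varying prime bases.
Why it might fail: ABC (and already Baker's ω-refinement at bounded ω) makes the conclusion false while the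
hypothesis may well be true — this arrow carries the anti-abc content of the crux in cell (II-U); no amplification
of quality 1⁺ to 1 + δ at bounded ω is known (polynomial breeding lowers quality, S-unit twisting is finite per
support). Sources: BakerWustholz2007 §3.7; Pasten2024 Thm 1.4(1); ScottStyer2004 = doi:10.1016/j.jnt.2003.11.008;
deWeger2026 §1, §5; route items UnbalancedFamily (stmt-ABC-1225), UnbalancedQuasiPolynomial (stmt-ABC-10558). -/
theorem stub_unbalancedHitsUpgrade :
    (∃ k : ℕ, ∃ η : ℝ, 0 < η ∧ {t : ℕ × ℕ × ℕ | IsABCTriple t.1 t.2.1 t.2.2 ∧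
      (t.1 * t.2.1 * t.2.2).primeFactors.card ≤ k ∧ rad t.1 t.2.1 t.2.2 < t.2.2 ∧
      ((min t.1 t.2.1 : ℕ) : ℝ) ≤ (t.2.2 : ℝ) ^ (1 - η)}.Infinite) →
    ∃ k : ℕ, ∃ δ : ℝ, 0 < δ ∧ {t : ℕ × ℕ × ℕ | IsABCTriple t.1 t.2.1 t.2.2 ∧
      (t.1 * t.2.1 * t.2.2).primeFactors.card ≤ k ∧ 1 + δ < quality t.1 t.2.1 t.2.2}.Infinite := by
  sorry

/-- **Stub 3 (UPGRADE in cell (II-B) — balanced bounded-ω hits upgrade to a δ-family).** If for some `k` and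
EVERY `η > 0` there are infinitely many abc hits with `ω(abc) ≤ k` and `c^(1−η) < min(a,b)` (the route's
`BalancedFamily` coordinate: at k = 3 these are three prime powers `p^x + q^y = r^z` with `pqr < r^z`, i.e.
Fermat–Catalan/Beal-type solutions in varying prime bases with `1/x + 1/y + 1/z < 1 + o(1)`), then for some
`k', δ > 0` there are infinitely many abc triples with `ω(abc) ≤ k'` and quality `> 1 + δ`. Implied by the crux.
The natural proof shape stays in the cell (conclude `BalancedFamily`): a balanced hit family has signatures
escaping every finite set (S-unit finiteness per support, Darmon–Granville per fixed hyperbolic signature), and the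
upgrade asks that `1/x + 1/y + 1/z ≤ 1/(1+δ)` — uniform hyperbolicity — holds along an infinite subfamily, the
only certified wall being the prime floor `PrimeFloorBoundedOmega` (P(abc) ≥ (log c)^{1−o(1)}).
Why it might fail: ABC makes the conclusion false while balanced bounded-ω hits with quality → 1⁺ (signatures
creeping to the Euclidean boundary `1/x+1/y+1/z → 1`) may still be infinite; Beal-type searches find no prime-base
solution with all exponents ≥ 3, and the ten known Fermat–Catalan solutions have quality ≤ 1.23.
Sources: DarmonGranville1995 Thm 2 = Literature.NumberTheory.DiophantineGeometry.darmon_granville;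
Literature.Barriers.ABC.TijdemanZagierNeedsExponentThree; arXiv:2206.14067; Nitaj1996; route items BalancedFamily
(stmt-ABC-1226), PrimeFloorBoundedOmega (stmt-ABC-10559). -/
theorem stub_balancedHitsUpgrade :
    (∃ k : ℕ, ∀ η : ℝ, 0 < η → {t : ℕ × ℕ × ℕ | IsABCTriple t.1 t.2.1 t.2.2 ∧
      (t.1 * t.2.1 * t.2.2).primeFactors.card ≤ k ∧ rad t.1 t.2.1 t.2.2 < t.2.2 ∧
      (t.2.2 : ℝ) ^ (1 - η) < ((min t.1 t.2.1 : ℕ) : ℝ)}.Infinite) →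
    ∃ k : ℕ, ∃ δ : ℝ, 0 < δ ∧ {t : ℕ × ℕ × ℕ | IsABCTriple t.1 t.2.1 t.2.2 ∧
      (t.1 * t.2.1 * t.2.2).primeFactors.card ≤ k ∧ 1 + δ < quality t.1 t.2.1 t.2.2}.Infinite := by
  sorry

/-! ## The seam (sorry-free): the atlas dichotomy at hit level -/

/-- **Hit-level atlas dichotomy.** An infinite family of bounded-ω hits at level `k` has, for some `η > 0`,
infinitely many η-unbalanced members, or else, for every `η > 0`, infinitely many η-balanced members (the
η-unbalanced part being finite, its complement in the infinite family is infinite). Pure logic; the hit-level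
copy of the route's support item `AtlasDichotomy`. [folklore] -/
theorem hits_cell_dichotomy {k : ℕ}
    (h : {t : ℕ × ℕ × ℕ | IsABCTriple t.1 t.2.1 t.2.2 ∧
      (t.1 * t.2.1 * t.2.2).primeFactors.card ≤ k ∧ rad t.1 t.2.1 t.2.2 < t.2.2}.Infinite) :
    (∃ η : ℝ, 0 < η ∧ {t : ℕ × ℕ × ℕ | IsABCTriple t.1 t.2.1 t.2.2 ∧
      (t.1 * t.2.1 * t.2.2).primeFactors.card ≤ k ∧ rad t.1 t.2.1 t.2.2 < t.2.2 ∧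
      ((min t.1 t.2.1 : ℕ) : ℝ) ≤ (t.2.2 : ℝ) ^ (1 - η)}.Infinite) ∨
    (∀ η : ℝ, 0 < η → {t : ℕ × ℕ × ℕ | IsABCTriple t.1 t.2.1 t.2.2 ∧
      (t.1 * t.2.1 * t.2.2).primeFactors.card ≤ k ∧ rad t.1 t.2.1 t.2.2 < t.2.2 ∧
      (t.2.2 : ℝ) ^ (1 - η) < ((min t.1 t.2.1 : ℕ) : ℝ)}.Infinite) := by
  by_cases hU : ∃ η : ℝ, 0 < η ∧ {t : ℕ × ℕ × ℕ | IsABCTriple t.1 t.2.1 t.2.2 ∧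
      (t.1 * t.2.1 * t.2.2).primeFactors.card ≤ k ∧ rad t.1 t.2.1 t.2.2 < t.2.2 ∧
      ((min t.1 t.2.1 : ℕ) : ℝ) ≤ (t.2.2 : ℝ) ^ (1 - η)}.Infinite
  · exact Or.inl hU
  · refine Or.inr fun η hη => ?_
    -- the η-unbalanced hits are finite …
    have hfin : {t : ℕ × ℕ × ℕ | IsABCTriple t.1 t.2.1 t.2.2 ∧
        (t.1 * t.2.1 * t.2.2).primeFactors.card ≤ k ∧ rad t.1 t.2.1 t.2.2 < t.2.2 ∧
        ((min t.1 t.2.1 : ℕ) : ℝ) ≤ (t.2.2 : ℝ) ^ (1 - η)}.Finite := by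
      by_contra hinf
      exact hU ⟨η, hη, hinf⟩
    -- … so their complement inside the infinite hit family is infinite, and it consists of η-balanced hits
    refine (h.sdiff hfin).mono ?_
    rintro t ⟨⟨ht, hk, hr⟩, hnot⟩
    refine ⟨ht, hk, hr, ?_⟩
    by_contra hle
    exact hnot ⟨ht, hk, hr, not_lt.mp hle⟩

/-! ## The composition: the three stubs prove the crux BY NAME -/

/-- **Composition (sorry-free).** Supply (h₁) gives an infinite hit family at some level `k`; the hit-level
dichotomy sends it to cell (II-U) for some `η > 0` (upgrade by h₂) or to cell (II-B) for every `η > 0` (upgrade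
by h₃). [folklore] -/
theorem negThesis_of_stubSigs
    (h₁ : ∃ k : ℕ, {t : ℕ × ℕ × ℕ | IsABCTriple t.1 t.2.1 t.2.2 ∧
      (t.1 * t.2.1 * t.2.2).primeFactors.card ≤ k ∧ rad t.1 t.2.1 t.2.2 < t.2.2}.Infinite)
    (h₂ : (∃ k : ℕ, ∃ η : ℝ, 0 < η ∧ {t : ℕ × ℕ × ℕ | IsABCTriple t.1 t.2.1 t.2.2 ∧
      (t.1 * t.2.1 * t.2.2).primeFactors.card ≤ k ∧ rad t.1 t.2.1 t.2.2 < t.2.2 ∧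
      ((min t.1 t.2.1 : ℕ) : ℝ) ≤ (t.2.2 : ℝ) ^ (1 - η)}.Infinite) →
      ∃ k : ℕ, ∃ δ : ℝ, 0 < δ ∧ {t : ℕ × ℕ × ℕ | IsABCTriple t.1 t.2.1 t.2.2 ∧
        (t.1 * t.2.1 * t.2.2).primeFactors.card ≤ k ∧ 1 + δ < quality t.1 t.2.1 t.2.2}.Infinite)
    (h₃ : (∃ k : ℕ, ∀ η : ℝ, 0 < η → {t : ℕ × ℕ × ℕ | IsABCTriple t.1 t.2.1 t.2.2 ∧
      (t.1 * t.2.1 * t.2.2).primeFactors.card ≤ k ∧ rad t.1 t.2.1 t.2.2 < t.2.2 ∧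
      (t.2.2 : ℝ) ^ (1 - η) < ((min t.1 t.2.1 : ℕ) : ℝ)}.Infinite) →
      ∃ k : ℕ, ∃ δ : ℝ, 0 < δ ∧ {t : ℕ × ℕ × ℕ | IsABCTriple t.1 t.2.1 t.2.2 ∧
        (t.1 * t.2.1 * t.2.2).primeFactors.card ≤ k ∧ 1 + δ < quality t.1 t.2.1 t.2.2}.Infinite) :
    NegThesis := by
  obtain ⟨k, hk⟩ := h₁
  rcases hits_cell_dichotomy hk with hU | hB
  · exact h₂ ⟨k, hU⟩
  · exact h₃ ⟨k, hB⟩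

/-- **THE SKELETON THEOREM.** The crux `Summit.ABC.ABC.Theses.NegOmegaAtlas.NegThesis`, concluded BY NAME from
the three declared stubs. [folklore] -/
theorem NegThesis_of : Summit.ABC.ABC.Theses.NegOmegaAtlas.NegThesis :=
  negThesis_of_stubSigs stub_boundedOmegaHits stub_unbalancedHitsUpgrade stub_balancedHitsUpgrade

/-! ## Exactness of the stub set (sorry-free) -/

/-- A δ-violator is a hit: for an abc triple, `1 + δ < quality` with `δ > 0` gives `rad(abc)^(1+δ) < c`
(`IsABCTriple.one_add_lt_quality_iff`) and `rad(abc) < rad(abc)^(1+δ)` since `rad(abc) ≥ 2`. [folklore] -/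
theorem rad_lt_of_one_add_lt_quality {a b c : ℕ} (ht : IsABCTriple a b c) {δ : ℝ} (hδ : 0 < δ)
    (hq : 1 + δ < quality a b c) : rad a b c < c := by
  have h1 : ((rad a b c : ℕ) : ℝ) ^ (1 + δ) < (c : ℝ) := (ht.one_add_lt_quality_iff δ).mp hq
  have hr : (1 : ℝ) < ((rad a b c : ℕ) : ℝ) := by exact_mod_cast ht.two_le_rad
  have h2 : ((rad a b c : ℕ) : ℝ) < ((rad a b c : ℕ) : ℝ) ^ (1 + δ) := by
    calc ((rad a b c : ℕ) : ℝ) = ((rad a b c : ℕ) : ℝ) ^ (1 : ℝ) := (Real.rpow_one _).symm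
      _ < ((rad a b c : ℕ) : ℝ) ^ (1 + δ) := Real.rpow_lt_rpow_of_exponent_lt hr (by linarith)
  exact_mod_cast h2.trans h1

/-- Stub 1 follows from the crux: a δ-violating family is a hit family at the same level. [folklore] -/
theorem hits_of_negThesis (h : NegThesis) :
    ∃ k : ℕ, {t : ℕ × ℕ × ℕ | IsABCTriple t.1 t.2.1 t.2.2 ∧
      (t.1 * t.2.1 * t.2.2).primeFactors.card ≤ k ∧ rad t.1 t.2.1 t.2.2 < t.2.2}.Infinite := by
  obtain ⟨k, δ, hδ, hinf⟩ := h
  refine ⟨k, hinf.mono ?_⟩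
  rintro t ⟨ht, hk, hq⟩
  exact ⟨ht, hk, rad_lt_of_one_add_lt_quality ht hδ hq⟩

/-- **Exactness.** The crux is EQUIVALENT to the conjunction of the three stub statements (the arrows conclude
the crux; the supply is its δ = 0 shadow). Hence no stub is refutable short of `¬NegThesis`, and refuting the
supply stub ("for every k only finitely many bounded-ω hits") refutes the crux. [folklore] -/
theorem crux_iff_stubs :
    NegThesis ↔
    ((∃ k : ℕ, {t : ℕ × ℕ × ℕ | IsABCTriple t.1 t.2.1 t.2.2 ∧
      (t.1 * t.2.1 * t.2.2).primeFactors.card ≤ k ∧ rad t.1 t.2.1 t.2.2 < t.2.2}.Infinite) ∧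
    ((∃ k : ℕ, ∃ η : ℝ, 0 < η ∧ {t : ℕ × ℕ × ℕ | IsABCTriple t.1 t.2.1 t.2.2 ∧
      (t.1 * t.2.1 * t.2.2).primeFactors.card ≤ k ∧ rad t.1 t.2.1 t.2.2 < t.2.2 ∧
      ((min t.1 t.2.1 : ℕ) : ℝ) ≤ (t.2.2 : ℝ) ^ (1 - η)}.Infinite) →
      ∃ k : ℕ, ∃ δ : ℝ, 0 < δ ∧ {t : ℕ × ℕ × ℕ | IsABCTriple t.1 t.2.1 t.2.2 ∧
        (t.1 * t.2.1 * t.2.2).primeFactors.card ≤ k ∧ 1 + δ < quality t.1 t.2.1 t.2.2}.Infinite) ∧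
    ((∃ k : ℕ, ∀ η : ℝ, 0 < η → {t : ℕ × ℕ × ℕ | IsABCTriple t.1 t.2.1 t.2.2 ∧
      (t.1 * t.2.1 * t.2.2).primeFactors.card ≤ k ∧ rad t.1 t.2.1 t.2.2 < t.2.2 ∧
      (t.2.2 : ℝ) ^ (1 - η) < ((min t.1 t.2.1 : ℕ) : ℝ)}.Infinite) →
      ∃ k : ℕ, ∃ δ : ℝ, 0 < δ ∧ {t : ℕ × ℕ × ℕ | IsABCTriple t.1 t.2.1 t.2.2 ∧
        (t.1 * t.2.1 * t.2.2).primeFactors.card ≤ k ∧ 1 + δ < quality t.1 t.2.1 t.2.2}.Infinite)) :=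
  ⟨fun h => ⟨hits_of_negThesis h, fun _ => h, fun _ => h⟩,
    fun h => negThesis_of_stubSigs h.1 h.2.1 h.2.2⟩

/-- The supply hypothesis of each arrow is itself a consequence of the crux in the corresponding cell: an
`UnbalancedFamily` is an infinite family of η-unbalanced bounded-ω hits (so stub 2 is the exact complement of the
route's rank-2 crux inside the crux), and likewise for `BalancedFamily` and stub 3. [folklore] -/
theorem cellHits_of_cellFamilies :
    (UnbalancedFamily → ∃ k : ℕ, ∃ η : ℝ, 0 < η ∧ {t : ℕ × ℕ × ℕ | IsABCTriple t.1 t.2.1 t.2.2 ∧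
      (t.1 * t.2.1 * t.2.2).primeFactors.card ≤ k ∧ rad t.1 t.2.1 t.2.2 < t.2.2 ∧
      ((min t.1 t.2.1 : ℕ) : ℝ) ≤ (t.2.2 : ℝ) ^ (1 - η)}.Infinite) ∧
    (BalancedFamily → ∃ k : ℕ, ∀ η : ℝ, 0 < η → {t : ℕ × ℕ × ℕ | IsABCTriple t.1 t.2.1 t.2.2 ∧
      (t.1 * t.2.1 * t.2.2).primeFactors.card ≤ k ∧ rad t.1 t.2.1 t.2.2 < t.2.2 ∧
      (t.2.2 : ℝ) ^ (1 - η) < ((min t.1 t.2.1 : ℕ) : ℝ)}.Infinite) := by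
  refine ⟨fun h => ?_, fun h => ?_⟩
  · obtain ⟨k, η, hη, δ, hδ, hinf⟩ := h
    refine ⟨k, η, hη, hinf.mono ?_⟩
    rintro t ⟨ht, hk, hmin, hq⟩
    exact ⟨ht, hk, rad_lt_of_one_add_lt_quality ht hδ hq, hmin⟩
  · obtain ⟨k, δ, hδ, hall⟩ := h
    refine ⟨k, fun η hη => (hall η hη).mono ?_⟩
    rintro t ⟨ht, hk, hmin, hq⟩
    exact ⟨ht, hk, rad_lt_of_one_add_lt_quality ht hδ hq, hmin⟩

/-! ## Inhabited in kind (sorry-free): one bounded-ω hit -/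

/-- The definitions compute: `5 + 27 = 32` is an abc hit with ω(abc) = 3 (`rad = 30 < 32`), a member of the
level-3 hit set of stub 1 (and η-unbalanced for `η ≤ 1 − log 5 / log 32`). [folklore] -/
theorem hit_5_27_32 :
    IsABCTriple 5 27 32 ∧ (5 * 27 * 32).primeFactors.card ≤ 3 ∧ rad 5 27 32 < 32 := by
  have hpf : (5 * 27 * 32).primeFactors = {2, 3, 5} := by
    rw [show (5 * 27 * 32 : ℕ) = (2 ^ 5 * 3 ^ 3) * 5 by norm_num,
      Nat.primeFactors_mul (by norm_num) (by norm_num), Nat.primeFactors_mul (by norm_num) (by norm_num),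
      Nat.primeFactors_prime_pow (by norm_num) Nat.prime_two,
      Nat.primeFactors_prime_pow (by norm_num) Nat.prime_three,
      Nat.Prime.primeFactors (by norm_num)]
    decide
  refine ⟨⟨by norm_num, by norm_num, by norm_num, by norm_num⟩, ?_, ?_⟩
  · rw [hpf]; decide
  · rw [rad_def, Nat.radical_eq_prod_primeFactors, hpf]; decide

end Summit.ABC.ABC.Cruxes.NegThesis.Birth
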